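import Literature.AlgebraicGeometry.Resolution.ExceptionalDivisorGenericOrder
import Literature.AlgebraicGeometry.Resolution.ExceptionalDivisorRegularGlobal
import Literature.AlgebraicGeometry.Resolution.RegularBlowup
import Literature.AlgebraicGeometry.Resolution.RegularCentreRsopGenerated
import Literature.AlgebraicGeometry.Resolution.OrderSemicontinuityPointwise
import Literature.AlgebraicGeometry.Resolution.BlowupDisjointCentreSplitting
import Literature.AlgebraicGeometry.Resolution.BlowupOffCentre
import Literature.AlgebraicGeometry.Resolution.ColonIdealSheafFG
import Literature.AlgebraicGeometry.Resolution.PrimeDivisorIdeals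
import Literature.AlgebraicGeometry.Resolution.KollarTripleBlowup
import Literature.AlgebraicGeometry.Resolution.RegularLocalRingsUFD
import Literature.AlgebraicGeometry.Resolution.BlowupSNC
import HarnessLib

/-!
# The controlled transform of an effective Cartier divisor along a regular irreducible centre, with the weight equal
# to the generic order: it is again an effective Cartier divisor, and its support is the closure of the preimage of
# the divisor off the centre

Topic: `Literature/AlgebraicGeometry/Resolution`. Let `W` be a locally Noetherian REGULAR scheme, `𝓗` an effective
Cartier divisor (ideal sheaf locally generated by one regular element), `C` the ideal of a REGULAR closed subscheme whose
support `V(C)` is irreducible with generic point `η`, `m := ord_η(𝓗)` the generic order of `𝓗` along `V(C)`, and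
`τ : W′ → W` a blowing up along `C` with exceptional divisor `E = V(C 𝒪_{W′})`. Then (Bierstone–Grigoriev–Milman–
Włodarczyk 2011, §3.2 with Lemma 3.2.1: the controlled transform `τᶜ(𝓗, m) = 𝓘_E^{-m} · τ^*𝓗`; Kollár 2007, 3.30.2; the
order of `τ^*𝓗` along `E` is the `𝔪_η`-adic order `m` of `𝓗`, Cossart–Piltant 2008, proof of Prop. 4.2, (10)–(11)):

* `le_pow_of_idealOrder_genericPoint_eq` — `𝓗 ⊆ C^m` (the order can only grow under specialisation on a regular
  scheme, tree `idealOrder_le_of_specializes`; `C^m` collects every ideal of order `≥ m` along the regular centre,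
  tree `le_pow_of_isRegular_subscheme_of_forall_le_idealOrder_of_isRegular`);
* `IsBlowup.comap_eq_pow_mul_controlledTransform_of_le_pow` — `τ^*𝓗 = 𝓘_E^m · τᶜ(𝓗, m)`;
* `IsBlowup.isEffectiveCartier_controlledTransform_of_le_pow` — `τᶜ(𝓗, m)` is an effective Cartier divisor;
* `IsBlowup.closure_preimage_diff_subset_support_controlledTransform` — `cl(τ⁻¹(V(𝓗) ∖ V(C))) ⊆ Supp τᶜ(𝓗, b)` for
  every `b` (no regularity needed);
* **`IsBlowup.support_controlledTransform_eq_closure`** — `Supp τᶜ(𝓗, m) = cl(τ⁻¹(V(𝓗) ∖ V(C)))`: the controlled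
  transform with the generic weight has NO component inside the exceptional divisor. Proof at a point `x′ ∈ E`:
  `𝒪_{W′,x′}` is regular (Liu 8.1.19 (a), tree `IsBlowup.isRegular_of_isRegular_subscheme`), `τᶜ(𝓗, m)_{x′} = (f)`,
  `𝓘_{E,x′} = (e)` with `e` PRIME (`E` is a regular scheme, tree `IsBlowup.isRegular_subscheme_comap`); if the support
  of `(f)` lies inside `E` near `x′` then `e ∈ √(f)`, so `f ~ e^j` (Mathlib `dvd_prime_pow`), `j ≥ 1`, `(f) ⊆ (e)` at
  `x′` hence at the generic point `ζ` of the irreducible `E` (Liu 8.1.19 (b), tree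
  `IsBlowup.isIrreducible_preimage_of_isRegular`), forcing `ord_ζ τᶜ(𝓗, m) ≥ 1` — whereas
  `ord_ζ τᶜ(𝓗, m) = ord_η 𝓗 − m = 0` (tree `IsBlowup.idealOrder_controlledTransform_genericPoint_preimage`);
* `IsBlowup.support_controlledTransform_eq_closure_of_mem_support` — the same with the nowhere-density of `V(C)`
  derived from `η ∈ V(𝓗)` (an effective Cartier divisor is nowhere dense, tree `IsEffectiveCartier.dense_compl_support`).
* `Scheme.IsRegular.isIrreducible_support_of_isPreconnected`, `…exists_isGenericPoint_support_of_isPreconnected` —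
  the entry from a CONNECTED regular centre (the `IsPreconnected V(C)` clause of a split weighted step) to the binder
  `IsGenericPoint η V(C)` of this file;
* `IsBlowup.not_controlledTransform_le_comap_of_idealOrder_genericPoint_eq(')` — the global form `τᶜ(𝓗, m) ⊄ 𝓘_E`
  (exceptional divisor non-empty, resp. automatically so);
* **`IsBlowup.strictTransformIdeal_eq_controlledTransform`** — `⋃ₙ (τ^*𝓗 : 𝓘_Eⁿ) = τᶜ(𝓗, m)`: the strict transform
  of the divisor IS the controlled transform with the generic weight (the local equation of `τᶜ(𝓗, m)` is prime to
  that of `E` in the factorial local rings of `W′`, Auslander–Buchsbaum, tree `uniqueFactorizationMonoid_of_isRegularLocalRing`).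

Written for the HIRONAKA-L lane of cell res-hironaka (L W5.2, T5-E brick (L-A) of res-D-pv-054's re-cut
2026-08-27T07:50:48Z: the host hypersurface of a weighted blow-up step is threaded as `𝓗_{j+1} = τᶜ(𝓗_j, m)`) by
res-D-pv-026. Everything is proved; no definitions.

## Sources

* E. Bierstone, D. Grigoriev, P. Milman, J. Włodarczyk, arXiv:1206.3090, §3.2, Lemma 3.2.1.
  [BierstoneGrigorievMilmanWlodarczyk2011]
* J. Kollár, *Lectures on Resolution of Singularities* (2007), 3.30.2 (birational transforms of divisors).
  [Kollar2007]
* Q. Liu, *Algebraic Geometry and Arithmetic Curves* (2002), Thm. 8.1.19 (a), (b). [Liu2002]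
* V. Cossart, O. Piltant, J. Algebra 320 (2008), proof of Prop. 4.2, (10)–(11). [CossartPiltant2008]
-/

noncomputable section

open CategoryTheory CategoryTheory.Limits AlgebraicGeometry TopologicalSpace IsLocalRing

namespace Literature.AlgebraicGeometry.Resolution

universe u

open Scheme.IdealSheafData

variable {W W' : Scheme.{u}} {τ : W' ⟶ W} {C 𝓗 : W.IdealSheafData} {η : W} {m : ℕ}

/-! ## The weight: `𝓗 ⊆ C^m` for `m` the generic order along the centre -/

/-- **`𝓗 ⊆ C^m` when `ord_η(𝓗) = m` at the generic point `η` of the regular centre `V(C)` of a regular locally Noetherian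
scheme `W`**: orders grow under specialisation, and `C^m` contains every ideal sheaf of order `≥ m` at all points of the
regular centre (BGMW Lemma 3.2.1 (1)). [cite: BierstoneGrigorievMilmanWlodarczyk2011, Lemma 3.2.1 (1)] -/
theorem le_pow_of_idealOrder_genericPoint_eq [IsLocallyNoetherian W] (hW : Scheme.IsRegular W)
    (hC : Scheme.IsRegular C.subscheme) (hη : IsGenericPoint η (C.support : Set W)) (hm : idealOrder 𝓗 η = m) :
    𝓗 ≤ C ^ m := by
  refine le_pow_of_isRegular_subscheme_of_forall_le_idealOrder_of_isRegular hW hC fun y hy => ?_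
  haveI : IsRegularLocalRing (W.presheaf.stalk y) := hW y
  rw [← hm]
  exact idealOrder_le_of_specializes (hη.specializes hy) 𝓗

/-! ## The controlled transform with weight `m` -/

/-- **`τ^*𝓗 = 𝓘_E^m · τᶜ(𝓗, m)`** for a blowing up `τ` along `C` and `𝓗 ⊆ C^m` (BGMW §3.2: the controlled transform
is the quotient of the total transform by the `m`-th power of the invertible exceptional ideal).
[cite: BierstoneGrigorievMilmanWlodarczyk2011, §3.2] -/
theorem IsBlowup.comap_eq_pow_mul_controlledTransform_of_le_pow (hτ : IsBlowup τ C) (h : 𝓗 ≤ C ^ m) :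
    𝓗.comap τ = C.comap τ ^ m * controlledTransform τ C 𝓗 m :=
  (hτ.pow_mul_controlledTransform_eq (comap_le_comap_pow_of_le_pow h τ)).symm

/-- **The controlled transform of an effective Cartier divisor is an effective Cartier divisor** (`𝓗 ⊆ C^m`): the total
transform `τ^*𝓗` is effective Cartier (Stacks 0809, tree `IsEffectiveCartier.comap_of_isBlowup`) and equals
`𝓘_E^m · τᶜ(𝓗, m)`, and a factor of an effective Cartier product is effective Cartier (Stacks 07ZV).
[cite: Kollar2007, 3.30.2] -/
theorem IsBlowup.isEffectiveCartier_controlledTransform_of_le_pow (hτ : IsBlowup τ C)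
    (h𝓗 : IsEffectiveCartier 𝓗) (h : 𝓗 ≤ C ^ m) :
    IsEffectiveCartier (controlledTransform τ C 𝓗 m) := by
  have h1 : IsEffectiveCartier (𝓗.comap τ) := h𝓗.comap_of_isBlowup hτ
  rw [hτ.comap_eq_pow_mul_controlledTransform_of_le_pow h] at h1
  exact h1.of_mul_right

/-! ## The support of the controlled transform -/

/-- Off the centre a point lies on the controlled transform iff it lies over the divisor. [cite: BierstoneGrigorievMilmanWlodarczyk2011, §3.2] -/
theorem IsBlowup.mem_support_controlledTransform_iff_of_not_mem (hτ : IsBlowup τ C) (b : ℕ) {x' : W'}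
    (hx : τ x' ∉ (C.support : Set W)) :
    x' ∈ (controlledTransform τ C 𝓗 b).support ↔ τ x' ∈ 𝓗.support := by
  rw [mem_support_iff_stalkIdeal_le, hτ.stalkIdeal_controlledTransform_of_not_mem 𝓗 b hx,
    ← mem_support_iff_stalkIdeal_le, support_comap]
  rfl

/-- **`cl(τ⁻¹(V(𝓗) ∖ V(C))) ⊆ Supp τᶜ(𝓗, b)`** for every weight `b`: off the centre the controlled transform is the
total transform, whose support is the preimage of `V(𝓗)`, and supports are closed.
[cite: BierstoneGrigorievMilmanWlodarczyk2011, §3.2] -/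
theorem IsBlowup.closure_preimage_diff_subset_support_controlledTransform (hτ : IsBlowup τ C) (b : ℕ) :
    closure (τ ⁻¹' ((𝓗.support : Set W) \ C.support)) ⊆ ((controlledTransform τ C 𝓗 b).support : Set W') := by
  refine closure_minimal (fun x' hx' => ?_) (controlledTransform τ C 𝓗 b).support.isClosed
  exact (hτ.mem_support_controlledTransform_iff_of_not_mem b hx'.2).mpr hx'.1

/-- In a local ring, an element associated to the `0`-th power of anything generates the unit ideal; recorded as:
`Associated f (e ^ 0)` forces `Ideal.span {f} = ⊤`. [cite: Kollar2007, 3.30.2] -/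
private theorem span_eq_top_of_associated_pow_zero {A : Type*} [CommRing A] {f e : A} (h : Associated f (e ^ 0)) :
    Ideal.span ({f} : Set A) = ⊤ := by
  rw [pow_zero] at h
  rw [Ideal.span_singleton_eq_top]
  exact h.symm.isUnit isUnit_one

/-- **The controlled transform with the generic weight is not divisible by the exceptional divisor at any point**:
in the setting of `IsBlowup.support_controlledTransform_eq_closure` (centre written as `𝓘(D)`), at every point `x′`
of `E = τ⁻¹(D)` the stalk of `τᶜ(𝓗, m)` is NOT contained in the stalk of `𝓘_E` — otherwise the containment persists at
the generic point `ζ` of the irreducible `E` (Liu 8.1.19 (b)), giving `ord_ζ τᶜ(𝓗, m) ≥ 1`, whereas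
`ord_ζ τᶜ(𝓗, m) = ord_η 𝓗 − m = 0` (Cossart–Piltant 2008, proof of Prop. 4.2, (10)–(11)).
[cite: CossartPiltant2008, proof of Prop. 4.2, (10)–(11)] -/
theorem IsBlowup.not_stalkIdeal_controlledTransform_le_of_idealOrder_genericPoint_eq [IsLocallyNoetherian W]
    [IsLocallyNoetherian W'] (hW : Scheme.IsRegular W) {D : Closeds W}
    (hD : Scheme.IsRegular (vanishingIdeal D).subscheme) (hη : IsGenericPoint η (D : Set W))
    (hint : interior (D : Set W) = ∅) (hm : idealOrder 𝓗 η = m) (hτ : IsBlowup τ (vanishingIdeal D)) {x' : W'}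
    (hx : τ x' ∈ (D : Set W)) :
    ¬ stalkIdeal (controlledTransform τ (vanishingIdeal D) 𝓗 m) x' ≤ stalkIdeal ((vanishingIdeal D).comap τ) x' := by
  intro hKE
  set K := controlledTransform τ (vanishingIdeal D) 𝓗 m with hK
  set E := (vanishingIdeal D).comap τ with hE
  have hDsupp : ((vanishingIdeal D).support : Set W) = D := coe_support_vanishingIdeal D
  have hirrD : IsIrreducible (D : Set W) := hη.isIrreducible
  have hirrE : IsIrreducible (τ ⁻¹' (D : Set W)) := IsBlowup.isIrreducible_preimage_of_isRegular hW hD hirrD hint hτ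
  obtain ⟨ζ, hζ⟩ := QuasiSober.sober hirrE (D.isClosed.preimage τ.continuous)
  have hζx : ζ ⤳ x' := hζ.specializes hx
  have hKEζ : stalkIdeal K ζ ≤ stalkIdeal E ζ := by
    rw [← stalkIdeal_map_stalkSpecializes K hζx, ← stalkIdeal_map_stalkSpecializes E hζx]
    exact Ideal.map_mono hKE
  have hζE : ζ ∈ E.support := by
    rw [hE, support_comap]; show τ ζ ∈ ((vanishingIdeal D).support : Set W); rw [hDsupp]; exact hζ.mem
  have hord1 : ((1 : ℕ) : ℕ∞) ≤ idealOrder K ζ := by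
    rw [le_idealOrder_iff, pow_one]
    exact hKEζ.trans ((mem_support_iff_stalkIdeal_le E ζ).mp hζE)
  -- whereas `ord_ζ K = ord_{τ ζ} 𝓗 - m = ord_η 𝓗 - m = 0`
  have hgen : IsGenericPoint (τ ζ) (D : Set W) := hτ.isGenericPoint_of_isGenericPoint_preimage hW hD hirrD hint hζ
  have hτζ : τ ζ = η := hgen.eq hη
  have hord0 : idealOrder K ζ = 0 := by
    rw [hK, hτ.idealOrder_controlledTransform_genericPoint_preimage hW hD hirrD hint hζ 𝓗 m, hτζ, hm]
    simp
  rw [hord0] at hord1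
  exact absurd hord1 (by simp)

/-- **The support of the controlled transform with the generic weight**: for `W` regular locally Noetherian, `V(C)`
regular, irreducible with generic point `η` and nowhere dense, `𝓗` effective Cartier with `ord_η 𝓗 = m`, and `τ` a
blowing up along `C`: `Supp τᶜ(𝓗, m) = cl(τ⁻¹(V(𝓗) ∖ V(C)))` — no component of the controlled transform lies in the
exceptional divisor (the «strict transform» of the divisor, Kollár 3.30.2, BGMW §3.2).
[cite: Kollar2007, 3.30.2] -/
theorem IsBlowup.support_controlledTransform_eq_closure [IsLocallyNoetherian W] (hW : Scheme.IsRegular W)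
    (hC : Scheme.IsRegular C.subscheme) (hη : IsGenericPoint η (C.support : Set W))
    (hint : interior (C.support : Set W) = ∅) (hm : idealOrder 𝓗 η = m) (h𝓗 : IsEffectiveCartier 𝓗)
    (hτ : IsBlowup τ C) :
    ((controlledTransform τ C 𝓗 m).support : Set W') = closure (τ ⁻¹' ((𝓗.support : Set W) \ C.support)) := by
  haveI : IsLocallyNoetherian W' := hτ.isLocallyNoetherian
  have hle : 𝓗 ≤ C ^ m := le_pow_of_idealOrder_genericPoint_eq hW hC hη hm
  refine le_antisymm (fun x' hx' => ?_) (hτ.closure_preimage_diff_subset_support_controlledTransform m)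
  by_contra hcl
  by_cases hxC : τ x' ∈ (C.support : Set W)
  swap
  · -- off the centre the point lies over `V(𝓗) ∖ V(C)`
    exact hcl (subset_closure ⟨(hτ.mem_support_controlledTransform_iff_of_not_mem m hxC).mp hx', hxC⟩)
  -- over the centre. The centre is reduced: `C = 𝓘(D)`, `D = V(C)`
  obtain ⟨D, rfl⟩ : ∃ D : Closeds W, C = vanishingIdeal D := ⟨_, eq_vanishingIdeal_support_of_isRegular C hC⟩
  have hDsupp : ((vanishingIdeal D).support : Set W) = D := coe_support_vanishingIdeal D
  rw [hDsupp] at hη hint hxC hcl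
  set K := controlledTransform τ (vanishingIdeal D) 𝓗 m with hK
  set E := (vanishingIdeal D).comap τ with hE
  -- regularity upstairs; the stalk at `x'`
  have hW' : Scheme.IsRegular W' := IsBlowup.isRegular_of_isRegular_subscheme hW hC hτ
  haveI : IsRegularLocalRing (W'.presheaf.stalk x') := hW' x'
  haveI := isDomain_of_isRegularLocalRing (W'.presheaf.stalk x')
  -- `K_{x'} = (f)`, `E_{x'} = (e)` with `e` prime
  obtain ⟨f, -, hf⟩ := (hτ.isEffectiveCartier_controlledTransform_of_le_pow h𝓗 hle).exists_stalkIdeal_eq_span x'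
  obtain ⟨e, he0, he⟩ := hτ.isEffectiveCartier.exists_stalkIdeal_eq_span x'
  have hxE : x' ∈ E.support := by
    rw [hE, support_comap]; show τ x' ∈ ((vanishingIdeal D).support : Set W); rwa [hDsupp]
  have hEreg : Scheme.IsRegular E.subscheme := IsBlowup.isRegular_subscheme_comap hW hC hτ
  have hprime : Prime e := by
    have hq : IsRegularLocalRing (W'.presheaf.stalk x' ⧸ stalkIdeal E x') :=
      (Scheme.isRegular_subscheme_iff E).mp hEreg x' hxE
    haveI := isDomain_of_isRegularLocalRing (W'.presheaf.stalk x' ⧸ stalkIdeal E x')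
    have hp : (stalkIdeal E x').IsPrime := (Ideal.Quotient.isDomain_iff_prime _).mp inferInstance
    rw [he] at hp
    exact (Ideal.span_singleton_prime (nonZeroDivisors.ne_zero he0)).mp hp
  -- near `x'` the support of `K` lies inside `E`, hence `e ∈ √(K_{x'})`
  have hrad : e ∈ (stalkIdeal K x').radical := by
    -- an open neighbourhood of `x'` missing `τ⁻¹(V(𝓗) ∖ D)`
    obtain ⟨U, hU, hxU, hUS⟩ : ∃ U : Set W', IsOpen U ∧ x' ∈ U ∧
        U ∩ τ ⁻¹' ((𝓗.support : Set W) \ D) = ∅ := by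
      rw [mem_closure_iff] at hcl
      push Not at hcl
      obtain ⟨U, hU, hxU, h⟩ := hcl
      exact ⟨U, hU, hxU, h⟩
    -- on `U`: `Supp K ∩ U = (Supp K ∩ Supp E) ∩ U`
    have hgerm : ((K.support : Set W') ∩ U) = ((K.support ⊓ E.support : Closeds W') : Set W') ∩ U := by
      ext y
      simp only [Set.mem_inter_iff, Closeds.coe_inf]
      constructor
      · rintro ⟨hyK, hyU⟩
        refine ⟨⟨hyK, ?_⟩, hyU⟩
        by_contra hyE
        have hyC : τ y ∉ (D : Set W) := by
          intro h
          apply hyE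
          rw [hE]; show y ∈ ((vanishingIdeal D).comap τ).support
          rw [support_comap]; show τ y ∈ ((vanishingIdeal D).support : Set W); rwa [hDsupp]
        have hyC' : τ y ∉ ((vanishingIdeal D).support : Set W) := by rwa [hDsupp]
        have hyH : τ y ∈ 𝓗.support := (hτ.mem_support_controlledTransform_iff_of_not_mem m hyC').mp hyK
        have : y ∈ U ∩ τ ⁻¹' ((𝓗.support : Set W) \ D) := ⟨hyU, hyH, hyC⟩
        rw [hUS] at this
        exact this
      · rintro ⟨⟨hyK, -⟩, hyU⟩
        exact ⟨hyK, hyU⟩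
    have h1 : stalkIdeal (vanishingIdeal K.support) x' = stalkIdeal (vanishingIdeal (K.support ⊓ E.support)) x' :=
      stalkIdeal_vanishingIdeal_congr ⟨U, hU⟩ hxU hgerm
    have h2 : E ≤ vanishingIdeal (K.support ⊓ E.support) :=
      le_support_iff_le_vanishingIdeal.mp inf_le_right
    have h3 : stalkIdeal E x' ≤ stalkIdeal (vanishingIdeal K.support) x' := by
      rw [h1]; exact stalkIdeal_mono h2 x'
    rw [vanishingIdeal_support, stalkIdeal_radical, he, Ideal.span_singleton_le_iff_mem] at h3
    exact h3
  -- so `f ∼ e^j`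
  rw [hf] at hrad
  obtain ⟨k, hk⟩ := hrad
  rw [Ideal.mem_span_singleton] at hk
  obtain ⟨j, -, hj⟩ := (dvd_prime_pow hprime k).mp hk
  rcases Nat.eq_zero_or_pos j with hj0 | hjpos
  · -- `f` a unit: `x'` is not on the support
    rw [hj0] at hj
    have htop : stalkIdeal K x' = ⊤ := by rw [hf, span_eq_top_of_associated_pow_zero hj]
    have := (mem_support_iff_stalkIdeal_le K x').mp hx'
    rw [htop, top_le_iff] at this
    exact (maximalIdeal.isMaximal (W'.presheaf.stalk x')).ne_top this
  -- `j ≥ 1`: `K_{x'} ⊆ E_{x'}`, impossible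
  have hKE : stalkIdeal K x' ≤ stalkIdeal E x' := by
    rw [hf, he, Ideal.span_singleton_le_span_singleton]
    exact (dvd_pow_self e hjpos.ne').trans hj.symm.dvd
  exact hτ.not_stalkIdeal_controlledTransform_le_of_idealOrder_genericPoint_eq hW hC hη hint hm hxC hKE

/-! ## Nowhere density of the centre from `η ∈ V(𝓗)` -/

/-- A closed irreducible subset whose generic point lies on an effective Cartier divisor is nowhere dense (the divisor
is: its complement is dense, tree `IsEffectiveCartier.dense_compl_support`). [cite: GortzWedhorn2020, Remark 9.24] -/
theorem interior_eq_empty_of_isGenericPoint_of_mem_support [IsLocallyNoetherian W] {S : Set W}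
    (hη : IsGenericPoint η S) (h𝓗 : IsEffectiveCartier 𝓗) (hηH : η ∈ 𝓗.support) : interior S = ∅ := by
  have hsub : S ⊆ (𝓗.support : Set W) := by
    rw [← hη.def]
    exact closure_minimal (Set.singleton_subset_iff.mpr hηH) 𝓗.support.isClosed
  have h2 : interior (𝓗.support : Set W) = ∅ := interior_eq_empty_iff_dense_compl.mpr h𝓗.dense_compl_support
  exact Set.subset_eq_empty (interior_mono hsub) h2

/-- **The support of the controlled transform with the generic weight**, the centre lying generically on the divisor
(`η ∈ V(𝓗)`, equivalently `m ≥ 1`): `Supp τᶜ(𝓗, m) = cl(τ⁻¹(V(𝓗) ∖ V(C)))`. [cite: Kollar2007, 3.30.2] -/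
theorem IsBlowup.support_controlledTransform_eq_closure_of_mem_support [IsLocallyNoetherian W]
    (hW : Scheme.IsRegular W) (hC : Scheme.IsRegular C.subscheme) (hη : IsGenericPoint η (C.support : Set W))
    (hηH : η ∈ 𝓗.support) (hm : idealOrder 𝓗 η = m) (h𝓗 : IsEffectiveCartier 𝓗) (hτ : IsBlowup τ C) :
    ((controlledTransform τ C 𝓗 m).support : Set W') = closure (τ ⁻¹' ((𝓗.support : Set W) \ C.support)) :=
  hτ.support_controlledTransform_eq_closure hW hC hη (interior_eq_empty_of_isGenericPoint_of_mem_support hη h𝓗 hηH)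
    hm h𝓗

/-- With the generic weight positive the centre lies on the divisor: `1 ≤ m = ord_η 𝓗` gives `η ∈ V(𝓗)`.
[cite: BierstoneGrigorievMilmanWlodarczyk2011, §3.2] -/
theorem mem_support_of_idealOrder_eq_of_pos (hm : idealOrder 𝓗 η = m) (hpos : 0 < m) : η ∈ 𝓗.support := by
  rw [mem_support_iff_stalkIdeal_le, ← pow_one (maximalIdeal _), ← le_idealOrder_iff, hm]
  exact_mod_cast hpos

/-! ## Strict transform = controlled transform with the generic weight -/

/-- In a unique factorisation domain: if the prime `e` does not divide `f ≠ 0` and `x · e^n ∈ (e^m · f)`, then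
`x ∈ (f)`. [cite: Kollar2007, 3.30.2] -/
private theorem mem_span_of_mul_pow_mem {A : Type*} [CommRing A] [IsDomain A] [UniqueFactorizationMonoid A]
    {e f x : A} (he : Prime e) (hf : f ≠ 0) (hef : ¬ e ∣ f) {m n : ℕ}
    (h : x * e ^ n ∈ Ideal.span ({e ^ m * f} : Set A)) : x ∈ Ideal.span ({f} : Set A) := by
  rw [Ideal.mem_span_singleton] at h ⊢
  have h1 : f ∣ x * e ^ n := (dvd_mul_left f (e ^ m)).trans h
  refine UniqueFactorizationMonoid.dvd_of_dvd_mul_left_of_no_prime_factors hf (fun d hdf hde hd => ?_) h1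
  obtain ⟨i, -, hi⟩ := (dvd_prime_pow he n).mp hde
  rcases Nat.eq_zero_or_pos i with hi0 | hipos
  · rw [hi0, pow_zero] at hi
    exact hd.not_unit (hi.symm.isUnit isUnit_one)
  · exact hef (((dvd_pow_self e hipos.ne').trans hi.symm.dvd).trans hdf)

/-- **The strict transform of an effective Cartier divisor is its controlled transform with the generic weight**:
in the setting of `IsBlowup.support_controlledTransform_eq_closure`,
`⋃ₙ (τ^*𝓗 : 𝓘_Eⁿ) = τᶜ(𝓗, m) = 𝓘_E^{-m} τ^*𝓗` as ideal sheaves — the controlled transform is already saturated with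
respect to the exceptional divisor, since at every point of `E` its local equation `f` is prime to the (prime) local
equation `e` of `E` in the factorial local ring `𝒪_{W′,x′}` (Auslander–Buchsbaum), by
`IsBlowup.not_stalkIdeal_controlledTransform_le_of_idealOrder_genericPoint_eq`. (Kollár 3.30.2: for a divisor the
birational = strict transform is `τ^*D − m E`, `m` the multiplicity of `D` along the centre.) [cite: Kollar2007, 3.30.2] -/
theorem IsBlowup.strictTransformIdeal_eq_controlledTransform [IsLocallyNoetherian W] (hW : Scheme.IsRegular W)
    (hC : Scheme.IsRegular C.subscheme) (hη : IsGenericPoint η (C.support : Set W))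
    (hint : interior (C.support : Set W) = ∅) (hm : idealOrder 𝓗 η = m) (h𝓗 : IsEffectiveCartier 𝓗)
    (hτ : IsBlowup τ C) : strictTransformIdeal τ C 𝓗 = controlledTransform τ C 𝓗 m := by
  haveI : IsLocallyNoetherian W' := hτ.isLocallyNoetherian
  have hle : 𝓗 ≤ C ^ m := le_pow_of_idealOrder_genericPoint_eq hW hC hη hm
  obtain ⟨D, rfl⟩ : ∃ D : Closeds W, C = vanishingIdeal D := ⟨_, eq_vanishingIdeal_support_of_isRegular C hC⟩
  have hDsupp : ((vanishingIdeal D).support : Set W) = D := coe_support_vanishingIdeal D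
  rw [hDsupp] at hη hint
  refine le_antisymm (le_of_forall_stalkIdeal_le fun x' => ?_)
    (controlledTransform_le_strictTransformIdeal τ (vanishingIdeal D) 𝓗 m)
  set K := controlledTransform τ (vanishingIdeal D) 𝓗 m with hK
  set E := (vanishingIdeal D).comap τ with hE
  have htot : (stalkIdeal 𝓗 (τ x')).map (τ.stalkMap x').hom = stalkIdeal E x' ^ m * stalkIdeal K x' := by
    rw [← stalkIdeal_comap_eq_map_stalkMap, hτ.comap_eq_pow_mul_controlledTransform_of_le_pow hle, stalkIdeal_mul,
      stalkIdeal_pow]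
  rw [stalkIdeal_strictTransformIdeal τ (vanishingIdeal D) 𝓗 x', htot]
  refine iSup_le fun n => ?_
  intro x hx
  rw [Submodule.mem_colon] at hx
  by_cases hxC : τ x' ∈ (D : Set W)
  swap
  · -- off the centre the exceptional ideal is the unit ideal
    have hxC' : τ x' ∉ ((vanishingIdeal D).support : Set W) := by rwa [hDsupp]
    have htop : stalkIdeal E x' = ⊤ := hτ.stalkIdeal_comap_centre_eq_top hxC'
    have h1 := hx 1 (by rw [htop, Ideal.top_pow]; trivial)
    rw [htop, Ideal.top_pow, Ideal.top_mul, smul_eq_mul, mul_one] at h1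
    exact h1
  -- over the centre: `K_{x'} = (f)`, `E_{x'} = (e)`, `e` prime not dividing `f`, in the UFD `𝒪_{W',x'}`
  have hW' : Scheme.IsRegular W' := IsBlowup.isRegular_of_isRegular_subscheme hW hC hτ
  haveI : IsRegularLocalRing (W'.presheaf.stalk x') := hW' x'
  haveI := isDomain_of_isRegularLocalRing (W'.presheaf.stalk x')
  haveI : UniqueFactorizationMonoid (W'.presheaf.stalk x') :=
    uniqueFactorizationMonoid_of_isRegularLocalRing _ inferInstance
  obtain ⟨f, hf0, hf⟩ := (hτ.isEffectiveCartier_controlledTransform_of_le_pow h𝓗 hle).exists_stalkIdeal_eq_span x'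
  obtain ⟨e, he0, he⟩ := hτ.isEffectiveCartier.exists_stalkIdeal_eq_span x'
  have hxE : x' ∈ E.support := by
    rw [hE, support_comap]; show τ x' ∈ ((vanishingIdeal D).support : Set W); rwa [hDsupp]
  have hprime : Prime e := by
    have hEreg : Scheme.IsRegular E.subscheme := IsBlowup.isRegular_subscheme_comap hW hC hτ
    have hq : IsRegularLocalRing (W'.presheaf.stalk x' ⧸ stalkIdeal E x') :=
      (Scheme.isRegular_subscheme_iff E).mp hEreg x' hxE
    haveI := isDomain_of_isRegularLocalRing (W'.presheaf.stalk x' ⧸ stalkIdeal E x')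
    have hp : (stalkIdeal E x').IsPrime := (Ideal.Quotient.isDomain_iff_prime _).mp inferInstance
    rw [he] at hp
    exact (Ideal.span_singleton_prime (nonZeroDivisors.ne_zero he0)).mp hp
  have hef : ¬ e ∣ f := by
    intro h
    apply hτ.not_stalkIdeal_controlledTransform_le_of_idealOrder_genericPoint_eq hW hC hη hint hm hxC
    rw [← hK, ← hE, hf, he, Ideal.span_singleton_le_span_singleton]
    exact h
  rw [hf]
  rw [hf, he, Ideal.span_singleton_pow, Ideal.span_singleton_pow, Ideal.span_singleton_mul_span_singleton] at hx
  exact mem_span_of_mul_pow_mem hprime (nonZeroDivisors.ne_zero hf0) hef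
    (by simpa [smul_eq_mul] using hx (e ^ n) (Ideal.mem_span_singleton_self _))

/-! ## Entry from a connected regular centre (the `IsPreconnected` clause of a split weighted step) -/

/-- **A regular closed subscheme with (pre)connected non-empty support is irreducible** (`X` locally Noetherian with
Noetherian underlying space): the irreducible components of `V(C)` are pairwise disjoint closed (regular local rings
are domains, tree `isPiecePartition_boundaryPieces_of_isRegular`), so a preconnected `V(C)` is one of them
(Stacks 0357: a normal Noetherian scheme is the disjoint union of its integral components).
[cite: StacksProject, Tag 0357] -/
theorem Scheme.IsRegular.isIrreducible_support_of_isPreconnected {X : Scheme.{u}} [IsLocallyNoetherian X]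
    [NoetherianSpace X] {C : X.IdealSheafData} (hC : Scheme.IsRegular C.subscheme)
    (hconn : _root_.IsPreconnected (C.support : Set X)) (hne : (C.support : Set X).Nonempty) :
    IsIrreducible (C.support : Set X) := by
  classical
  obtain ⟨x, hx⟩ := hne
  have hP := isPiecePartition_boundaryPieces_of_isRegular hC
  obtain ⟨Z, hZ, hxZ⟩ := hP.exists_mem hx
  -- the union of the other components is closed, disjoint from `Z`, and with `Z` covers `V(C)`
  set v : Set X := ⋃ Z' ∈ (Kollar2007.boundaryPieces C).filter (fun Z' => Z' ≠ Z), (Z' : Set X) with hv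
  have hvc : IsClosed v :=
    (List.finite_toSet _).isClosed_biUnion fun (Z' : Closeds X) _ => Z'.isClosed
  have hcover : (C.support : Set X) ⊆ (Z : Set X) ∪ v := by
    intro y hy
    obtain ⟨Z', hZ', hyZ'⟩ := hP.exists_mem hy
    by_cases hZZ' : Z' = Z
    · exact Or.inl (hZZ' ▸ hyZ')
    · exact Or.inr (Set.mem_iUnion₂.mpr ⟨Z', List.mem_filter.mpr ⟨hZ', decide_eq_true hZZ'⟩, hyZ'⟩)
  have hdisj : (C.support : Set X) ∩ ((Z : Set X) ∩ v) = ∅ := by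
    apply Set.eq_empty_of_forall_notMem
    rintro y ⟨-, hyZ, hyv⟩
    simp only [hv, Set.mem_iUnion, List.mem_filter, exists_prop] at hyv
    obtain ⟨Z', ⟨hZ', hne'⟩, hyZ'⟩ := hyv
    exact (of_decide_eq_true hne') (hP.eq_of_mem hZ' hZ hyZ' hyZ)
  rcases (isPreconnected_iff_subset_of_disjoint_closed.mp hconn) Z v Z.isClosed hvc hcover hdisj with h | h
  · rw [Set.Subset.antisymm h (hP.subset hZ)]
    exact isIrreducible_of_mem_boundaryPieces hZ
  · exfalso
    have hxv := h hx
    simp only [hv, Set.mem_iUnion, List.mem_filter, exists_prop] at hxv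
    obtain ⟨Z', ⟨hZ', hne'⟩, hxZ'⟩ := hxv
    exact (of_decide_eq_true hne') (hP.eq_of_mem hZ' hZ hxZ' hxZ)

/-- Hence a regular centre with (pre)connected non-empty support HAS A GENERIC POINT `η` — the binder of this file's
theorems (`IsGenericPoint η V(C)`), produced from the `IsPreconnected (C.support)` clause of a split weighted blow-up
step. [cite: StacksProject, Tag 0357] -/
theorem Scheme.IsRegular.exists_isGenericPoint_support_of_isPreconnected {X : Scheme.{u}} [IsLocallyNoetherian X]
    [NoetherianSpace X] {C : X.IdealSheafData} (hC : Scheme.IsRegular C.subscheme)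
    (hconn : _root_.IsPreconnected (C.support : Set X)) (hne : (C.support : Set X).Nonempty) :
    ∃ η : X, IsGenericPoint η (C.support : Set X) :=
  QuasiSober.sober (hC.isIrreducible_support_of_isPreconnected hconn hne) C.support.isClosed

/-! ## Global form of the non-divisibility: the controlled transform is not contained in the exceptional ideal -/

/-- **`τᶜ(𝓗, m) ⊄ 𝓘_E`** (global form of `IsBlowup.not_stalkIdeal_controlledTransform_le_of_idealOrder_genericPoint_eq`,
the «no component in the exceptional divisor» clause of a split weighted blow-up step): for `W` regular locally
Noetherian, `V(C)` regular and nowhere dense with generic point `η`, `ord_η 𝓗 = m`, `τ` a blowing up along `C` with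
NON-EMPTY exceptional divisor, the controlled transform with the generic weight is not contained in the exceptional
ideal `C 𝒪_{W′}`. [cite: Kollar2007, 3.30.2] -/
theorem IsBlowup.not_controlledTransform_le_comap_of_idealOrder_genericPoint_eq [IsLocallyNoetherian W]
    (hW : Scheme.IsRegular W) (hC : Scheme.IsRegular C.subscheme) (hη : IsGenericPoint η (C.support : Set W))
    (hint : interior (C.support : Set W) = ∅) (hm : idealOrder 𝓗 η = m) (hτ : IsBlowup τ C)
    (hne : ((C.comap τ).support : Set W').Nonempty) : ¬ controlledTransform τ C 𝓗 m ≤ C.comap τ := by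
  intro hle
  haveI : IsLocallyNoetherian W' := hτ.isLocallyNoetherian
  obtain ⟨D, rfl⟩ : ∃ D : Closeds W, C = vanishingIdeal D := ⟨_, eq_vanishingIdeal_support_of_isRegular C hC⟩
  have hDsupp : ((vanishingIdeal D).support : Set W) = D := coe_support_vanishingIdeal D
  rw [hDsupp] at hη hint
  obtain ⟨x', hx'⟩ := hne
  have hxC : τ x' ∈ (D : Set W) := by
    rw [SetLike.mem_coe, support_comap] at hx'
    have h : τ x' ∈ ((vanishingIdeal D).support : Set W) := hx'
    rwa [hDsupp] at h
  exact hτ.not_stalkIdeal_controlledTransform_le_of_idealOrder_genericPoint_eq hW hC hη hint hm hxC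
    (stalkIdeal_mono hle x')

/-- The same with the non-emptiness put on the CENTRE: the exceptional divisor of the blowing up of a regular scheme
along a non-empty regular nowhere-dense irreducible centre is non-empty (`τ(τ⁻¹ V(C)) = V(C)`, Liu 8.1.19 (b), tree
`IsBlowup.image_preimage_eq_of_isRegular`). [cite: Liu2002, Thm. 8.1.19 (b)] -/
theorem IsBlowup.not_controlledTransform_le_comap_of_idealOrder_genericPoint_eq' [IsLocallyNoetherian W]
    (hW : Scheme.IsRegular W) (hC : Scheme.IsRegular C.subscheme) (hη : IsGenericPoint η (C.support : Set W))
    (hint : interior (C.support : Set W) = ∅) (hm : idealOrder 𝓗 η = m) (hτ : IsBlowup τ C) :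
    ¬ controlledTransform τ C 𝓗 m ≤ C.comap τ := by
  refine hτ.not_controlledTransform_le_comap_of_idealOrder_genericPoint_eq hW hC hη hint hm ?_
  obtain ⟨D, rfl⟩ : ∃ D : Closeds W, C = vanishingIdeal D := ⟨_, eq_vanishingIdeal_support_of_isRegular C hC⟩
  have hDsupp : ((vanishingIdeal D).support : Set W) = D := coe_support_vanishingIdeal D
  rw [hDsupp] at hη hint
  -- `η ∈ D = τ(τ⁻¹ D)`
  have himg := IsBlowup.image_preimage_eq_of_isRegular hW hC hη.isIrreducible hint hτ
  have hηD : η ∈ τ '' (τ ⁻¹' (D : Set W)) := by rw [himg]; exact hη.mem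
  obtain ⟨x', hx', -⟩ := hηD
  refine ⟨x', ?_⟩
  rw [SetLike.mem_coe, support_comap]
  show τ x' ∈ ((vanishingIdeal D).support : Set W)
  rw [hDsupp]
  exact hx'

end Literature.AlgebraicGeometry.Resolution

end
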